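import Summits.QuantumFields.BalabanUV.T4Continuum.Support.NE3EnergyPath
import HarnessLib

/-!
# T⁴ programme, node NE3 — THE ENDPOINT FORM OF THE ENERGY RESPONSE: minimality at ONE end (not along the path) and a
# residual with QUADRATIC SLACK at the other end suffice — `ℓ ≤ 2·r ∕ (m − 2q)`

NE3 (node U1b), row NE3 OWNER `b2b-balaban-t4-ne3-p1` (gen 24).  The route-(R3) response lemma of the tree,
`NE3EnergyPath.response_along_path` ∕ `energyResponse_of_pathData`, assumes MINIMALITY ALONG THE PATH
(`∀ t ∈ (0,1), φ 0 ≤ φ t`), which at the chart level is the field `ChartLeaves.adm` («the path stays in run A's fibre and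
class at every time») — the one clause that forces the chart's path to live INSIDE the non-linear fibre of the k-fold
average (B11 Prop. 3 TYPE).  THIS FILE records that the END needs LESS: if `φ″ ≥ m·ℓ²` on `[0,1]`, the END VALUES compare
(`φ 0 ≤ φ 1` — at the chart level: `A(U_A) ≤ A(W)` because `W = cavg L U_B` ALONE is admissible for run A, composition law
+ class transport, kernel) and the derivative at the competitor's end obeys `φ′ 1 ≤ r·ℓ + q·ℓ²` (a residual with a QUADRATIC
SLACK `q`, room for the first variation against a small non-tangent component), then `(m∕2 − q)·ℓ² ≤ r·ℓ`, so
`ℓ ≤ 2r∕(m − 2q)` — by `T4ConvexResponse.taylor_upper` BY NAME.  Consequence for the chart (owner design note D-ne3p1-g24-1,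
route Π): the path may LEAVE the fibre for `t ∈ (0,1)`; an explicit polynomial path `Γ t = (1−t)·PX₀ + (1−t)²·N` (tangent
part + quadratically small normal part) serves, and NO fixed point ∕ implicit function is needed for the path.

CONTENT ([folklore]; 0 def, 0 sorry): §1 `endpointResponse` (the one-variable lemma), `endpointResponse_half` (displayed
modulus under a budget); §2 **`energyResponse_of_endpointData`** — `NE3EnergyPath.energyResponse_of_pathData` with `hmin` REPLACED
by the endpoint comparison `φ 0 ≤ φ 1` and `hres` by the slack form, composing `NE3EnergyPath.strongConvexity_along_path` BY NAME;
§3 non-vacuity on `ℝ`.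

HONEST FRAMING.  Real analysis in one variable + the abstract Hessian bookkeeping of `NE3EnergyPath`; nothing about Bałaban's
minimisers; T-E_w♯, (P♮)_W, NE3 NOT proved; spine PROVED 0∕9; finite T⁴ rung (B)+1 — NOT infinite volume, NOT mass gap, NOT
`BetaPertH`, NOT Clay.  ABSOLUTE RULE kept (no printed sentence is a hypothesis; context: [Balaban1985Variational] Prop. 3 p. 289).
PLACEMENT: `Summits/QuantumFields/BalabanUV/`; imports the accepted `Support.NE3EnergyPath` only.  HONEST DEPENDENCY: continuum
YM on T⁴ ⇐ BetaPertH ∧ nine spine estimates (0/9 proved); BetaPertH ⇐ (D1) ∧ (D4) ∧ CAP+tail; G-an2-4 gates asym, D1 and NE2/3/4.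
-/

set_option autoImplicit false

namespace Summit.QuantumFields.BalabanUV.T4Continuum.NE3EndpointResponse

open Set
open Literature.MathematicalPhysics.QuantumFieldTheory.Balaban1983to89.T4ConvexResponse (taylor_upper)
open NE3EnergyPath (strongConvexity_along_path)

noncomputable section

/-! ## §1 The endpoint response in one variable -/

/-- **ENDPOINT RESPONSE (one variable).**  `φ` is C² on `[0,1]` with `φ″ ≥ m·ℓ²` (`ℓ ≥ 0`); the END VALUES compare,
`φ 0 ≤ φ 1`; and the derivative at `t = 1` obeys `φ′ 1 ≤ r·ℓ + q·ℓ²` (`r ≥ 0`).  If `2q < m` then `ℓ ≤ 2r∕(m − 2q)`.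
Proof: `taylor_upper` gives `φ 1 − φ 0 ≤ φ′ 1 − m·ℓ²∕2`, whence `(m∕2 − q)·ℓ² ≤ r·ℓ`. [folklore] -/
theorem endpointResponse {φ φ' φ'' : ℝ → ℝ} {m q r ℓ : ℝ}
    (h1 : ∀ t ∈ Icc (0:ℝ) 1, HasDerivAt φ (φ' t) t) (h2 : ∀ t ∈ Icc (0:ℝ) 1, HasDerivAt φ' (φ'' t) t)
    (hconv : ∀ t ∈ Icc (0:ℝ) 1, m * ℓ ^ 2 ≤ φ'' t) (hend : φ 0 ≤ φ 1)
    (hres : φ' 1 ≤ r * ℓ + q * ℓ ^ 2) (hm : 2 * q < m) (hℓ : 0 ≤ ℓ) (hr : 0 ≤ r) :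
    ℓ ≤ 2 * r / (m - 2 * q) := by
  have hup := taylor_upper h1 h2 hconv
  -- `(m/2 − q) ℓ² ≤ r ℓ`
  have hkey : (m - 2 * q) * ℓ ^ 2 ≤ 2 * r * ℓ := by nlinarith
  have hmq : 0 < m - 2 * q := by linarith
  rcases hℓ.eq_or_lt with hz | hpos
  · rw [← hz]; positivity
  · rw [le_div_iff₀ hmq]
    have h3 : (m - 2 * q) * ℓ * ℓ ≤ 2 * r * ℓ := by nlinarith
    have h4 := le_of_mul_le_mul_right h3 hpos
    linarith

/-- The endpoint response under a BUDGET: if `2q ≤ m∕2` then `ℓ ≤ 4r∕m`. [folklore] -/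
theorem endpointResponse_budget {φ φ' φ'' : ℝ → ℝ} {m q r ℓ : ℝ}
    (h1 : ∀ t ∈ Icc (0:ℝ) 1, HasDerivAt φ (φ' t) t) (h2 : ∀ t ∈ Icc (0:ℝ) 1, HasDerivAt φ' (φ'' t) t)
    (hconv : ∀ t ∈ Icc (0:ℝ) 1, m * ℓ ^ 2 ≤ φ'' t) (hend : φ 0 ≤ φ 1)
    (hres : φ' 1 ≤ r * ℓ + q * ℓ ^ 2) (hm : 0 < m) (hq : 2 * q ≤ m / 2) (hℓ : 0 ≤ ℓ) (hr : 0 ≤ r) :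
    ℓ ≤ 4 * r / m := by
  have h := endpointResponse h1 h2 hconv hend hres (by linarith) hℓ hr
  have hmq : m / 2 ≤ m - 2 * q := by linarith
  refine h.trans ?_
  rw [div_le_div_iff₀ (by linarith) hm]
  nlinarith

/-- **ACTION GAP, ENDPOINT FORM**: under the same hypotheses (no sign condition on `m − 2q` needed for the upper half),
`φ 1 − φ 0 ≤ r·ℓ + q·ℓ² − (m∕2)·ℓ²` — the competitor's action exceeds the minimum by at most the residual pairing minus the
convexity gain. [folklore] -/
theorem actionGap_endpoint {φ φ' φ'' : ℝ → ℝ} {m q r ℓ : ℝ}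
    (h1 : ∀ t ∈ Icc (0:ℝ) 1, HasDerivAt φ (φ' t) t) (h2 : ∀ t ∈ Icc (0:ℝ) 1, HasDerivAt φ' (φ'' t) t)
    (hconv : ∀ t ∈ Icc (0:ℝ) 1, m * ℓ ^ 2 ≤ φ'' t) (hres : φ' 1 ≤ r * ℓ + q * ℓ ^ 2) :
    φ 1 - φ 0 ≤ r * ℓ + q * ℓ ^ 2 - m / 2 * ℓ ^ 2 := by
  have hup := taylor_upper h1 h2 hconv
  linarith

/-! ## §2 The energy response from ENDPOINT data (abstract Hessian bookkeeping of `NE3EnergyPath`, by name) -/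

section Hessian

variable {E : Type*} [AddCommGroup E] [Module ℝ E]

/-- **THE ENERGY RESPONSE FROM ENDPOINT DATA.**  As `NE3EnergyPath.energyResponse_of_pathData` — the second derivative of
`φ = 𝒜 ∘ γ` splits as `φ″ t = Hs t (X + u t) (X + u t) + e t` with `Hs t` symmetric, `c`-coercive on `T`, `Λ`-continuous in the
gauge `N`, `X ∈ T`, `N (u t) ≤ θ·N X`, `|e t| ≤ κ·N X²` — but with MINIMALITY AT THE ENDS ONLY (`φ 0 ≤ φ 1`) and the residual
at the competitor WITH QUADRATIC SLACK (`φ′ 1 ≤ r·N X + q·N X²`).  If `m := c − 2Λθ − Λθ² − κ > 2q` then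
**`N X ≤ 2r∕(m − 2q)`**. [folklore] -/
theorem energyResponse_of_endpointData {φ φ' φ'' : ℝ → ℝ} (Hs : ℝ → E →ₗ[ℝ] E →ₗ[ℝ] ℝ)
    (hsymm : ∀ t ∈ Icc (0:ℝ) 1, ∀ x y, Hs t x y = Hs t y x) (N : E → ℝ) (hN : ∀ v, 0 ≤ N v) (T : Set E)
    {c Λ θ κ q r : ℝ} (hΛ : 0 ≤ Λ) (hr : 0 ≤ r)
    (hcoer : ∀ t ∈ Icc (0:ℝ) 1, ∀ Y ∈ T, c * N Y ^ 2 ≤ Hs t Y Y)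
    (hcont : ∀ t ∈ Icc (0:ℝ) 1, ∀ Y Z, |Hs t Y Z| ≤ Λ * N Y * N Z)
    {X : E} (hX : X ∈ T) (u : ℝ → E) (hu : ∀ t ∈ Icc (0:ℝ) 1, N (u t) ≤ θ * N X)
    (e : ℝ → ℝ) (he : ∀ t ∈ Icc (0:ℝ) 1, |e t| ≤ κ * N X ^ 2)
    (h1 : ∀ t ∈ Icc (0:ℝ) 1, HasDerivAt φ (φ' t) t) (h2 : ∀ t ∈ Icc (0:ℝ) 1, HasDerivAt φ' (φ'' t) t)
    (hsplit : ∀ t ∈ Icc (0:ℝ) 1, φ'' t = Hs t (X + u t) (X + u t) + e t)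
    (hend : φ 0 ≤ φ 1) (hres : φ' 1 ≤ r * N X + q * N X ^ 2)
    (hm : 2 * q < c - 2 * Λ * θ - Λ * θ ^ 2 - κ) :
    N X ≤ 2 * r / (c - 2 * Λ * θ - Λ * θ ^ 2 - κ - 2 * q) :=
  endpointResponse h1 h2
    (strongConvexity_along_path Hs hsymm N hN T hΛ hcoer hcont hX u hu e he hsplit) hend hres hm (hN X) hr

/-- Under the BUDGET `2Λθ + Λθ² + κ + 2q ≤ c∕2` the endpoint response reads `N X ≤ 4r∕c`. [folklore] -/
theorem energyResponse_of_endpointData_budget {φ φ' φ'' : ℝ → ℝ} (Hs : ℝ → E →ₗ[ℝ] E →ₗ[ℝ] ℝ)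
    (hsymm : ∀ t ∈ Icc (0:ℝ) 1, ∀ x y, Hs t x y = Hs t y x) (N : E → ℝ) (hN : ∀ v, 0 ≤ N v) (T : Set E)
    {c Λ θ κ q r : ℝ} (hΛ : 0 ≤ Λ) (hr : 0 ≤ r) (hc : 0 < c)
    (hcoer : ∀ t ∈ Icc (0:ℝ) 1, ∀ Y ∈ T, c * N Y ^ 2 ≤ Hs t Y Y)
    (hcont : ∀ t ∈ Icc (0:ℝ) 1, ∀ Y Z, |Hs t Y Z| ≤ Λ * N Y * N Z)
    {X : E} (hX : X ∈ T) (u : ℝ → E) (hu : ∀ t ∈ Icc (0:ℝ) 1, N (u t) ≤ θ * N X)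
    (e : ℝ → ℝ) (he : ∀ t ∈ Icc (0:ℝ) 1, |e t| ≤ κ * N X ^ 2)
    (h1 : ∀ t ∈ Icc (0:ℝ) 1, HasDerivAt φ (φ' t) t) (h2 : ∀ t ∈ Icc (0:ℝ) 1, HasDerivAt φ' (φ'' t) t)
    (hsplit : ∀ t ∈ Icc (0:ℝ) 1, φ'' t = Hs t (X + u t) (X + u t) + e t)
    (hend : φ 0 ≤ φ 1) (hres : φ' 1 ≤ r * N X + q * N X ^ 2)
    (hbudget : 2 * Λ * θ + Λ * θ ^ 2 + κ + 2 * q ≤ c / 2) :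
    N X ≤ 4 * r / c := by
  have hm : 2 * q < c - 2 * Λ * θ - Λ * θ ^ 2 - κ := by linarith
  have h := energyResponse_of_endpointData Hs hsymm N hN T hΛ hr hcoer hcont hX u hu e he h1 h2 hsplit hend hres hm
  have hden : c / 2 ≤ c - 2 * Λ * θ - Λ * θ ^ 2 - κ - 2 * q := by linarith
  refine h.trans ?_
  rw [div_le_div_iff₀ (by linarith) hc]
  nlinarith

end Hessian

/-! ## §3 Non-vacuity: the endpoint hypotheses are jointly satisfiable, with equality in the response -/

/-- Witness on `ℝ`: `φ t = ℓ²·(t² − t)`, `φ′ t = ℓ²·(2t − 1)`, `φ″ = 2ℓ²`, `m = 2`, `q = 0`, `r = ℓ`: `φ 0 = φ 1 = 0`,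
`φ′ 1 = ℓ² = r·ℓ`, and the bound `ℓ ≤ 2r∕m = ℓ` is attained — the endpoint hypotheses are jointly satisfiable and sharp. [folklore] -/
theorem endpointResponse_witness (ℓ : ℝ) (hℓ : 0 ≤ ℓ) : ℓ ≤ 2 * ℓ / (2 - 2 * 0) := by
  have h := endpointResponse (φ := fun t => ℓ ^ 2 * (t ^ 2 - t)) (φ' := fun t => ℓ ^ 2 * (2 * t - 1))
    (φ'' := fun _ => 2 * ℓ ^ 2) (m := 2) (q := 0) (r := ℓ) (ℓ := ℓ)
    (fun t _ => (((hasDerivAt_pow 2 t).sub (hasDerivAt_id' t)).const_mul (ℓ ^ 2)).congr_deriv (by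
      simp only [Nat.cast_ofNat]; ring))
    (fun t _ => ((((hasDerivAt_id' t).const_mul (2:ℝ)).sub_const (1:ℝ)).const_mul (ℓ ^ 2)).congr_deriv (by ring))
    (fun t _ => by nlinarith) (by norm_num) (by nlinarith) (by norm_num) hℓ hℓ
  exact h

end

end Summit.QuantumFields.BalabanUV.T4Continuum.NE3EndpointResponse
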